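import Literature.NumberTheory.EllipticCurves.ThreeTorsionDescentValuation
import Literature.NumberTheory.EllipticCurves.MordellCurveCubicDescentLocal
import HarnessLib

/-!
# The local image of the `3`-descent map `y − (mx + s)` at a place of multiplicative reduction where the
# `3`-torsion point `T = (0, s)` stays smooth: every descent value is a cube times a `1`-unit
# (Cohen–Pazuki 2009, Thm. 2.1 / §4, the local conditions at `p ∣ 27b − 4a³`, `p ∤ 6b`)

Topic `NumberTheory/EllipticCurves`. Sequel of `ThreeTorsionDescentValuation` (the unramified places) in the
style of `TwoIsogenyLocalImageNode` (the `2`-isogeny analogue). Let `L` be a field with a `ℤᵐ⁰`-valued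
valuation `v` (e.g. a completion `K_w` of a number field), `W = threeTorsionModel m s : y² = x³ + (mx + s)²`
with `v(2) = v(3) = 1`, `v(s) = 1` and `v(27s − 4m³) < 1`: modulo `𝔪_v` the curve is the NODAL cubic
`y² = (x + μ²)(x + 4μ²)²` (`μ = m/3`, a `v`-unit; node `N = (−4μ², 0)`), and `T = (0, s)` reduces to a smooth
point. Then the `3`-descent map `α = ThreeTorsionDescent.descent` (`(x, y) ↦ y − (mx + s)`, `O ↦ 1`,
`T ↦ (2s)²`, Cohen–Pazuki Def. 1.3 with `D = 1`) satisfies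

* **`threeTorsionDescent_eq_cube_mul_one_add`** — `α(P) = c³ (1 + ε)` with `c ≠ 0`, `v(ε) < 1`, for EVERY
  `P ∈ W(L)`.

So at such a place the local image of `α` is contained in `(1 + 𝔪_v) L*³`: a Selmer candidate `u` (a `v`-unit)
survives the local condition only if its residue is a CUBE in the residue field — the local condition that
the crude `S`-unit box of `CPMuDescentBoxes` / `CPMuDescentK3Box` ignores. (By Tate's parametrisation the image is
in fact trivial: `T` lies on the identity component, the quotient by `⟨T⟩` triples the component group, and
the cokernel of the dual isogeny on `L`-points is `#μ₃(L) · c(E)/c(E') = 1`; the elementary proof below needs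
no reduction theory.) Proof: with `u = x + 4μ²`, `δ = s − 4μ³` (`v(δ) < 1`), `L = mx + s`, `A = y − L`,
`B = y + L`, `AB = x³`: (i) `v(x) > 1`: `v(L) = v(x)` and `AB = x³`, `B = A + 2L` force `v(A) > v(L)`, so
`A = (A/x)³ (1 + 2L/A)`; (ii) `v(u) < 1` (the point reduces to the node): `v(y) < 1` and `A ≡ 8μ³ = (2μ)³`;
(iii) `v(u) = 1`, `z = y − μu` a unit: the identity `u³ A = z³ − δ (u³ + (y − 3μu)(6μu − 16μ³ + δ))` (the
nodal cubic is parametrised by `t = y/u`, along which `A = (t − μ)³`) gives `A = (z/u)³ (1 + ε)`;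
(iv) `v(u) = 1`, `v(z) < 1` (the point reduces to `T`): `u²x = 2μuz + z² − δ(…)` gives `v(x) < 1`,
`B ≡ 8μ³`, and `A = x³/B = (x/2μ)³ (1 + (8μ³ − B)/B)`; at `T` itself `(2s)² = (4μ²)³ (1 + δ(8μ³ + δ)/16μ⁶)`.
Theorems only; no definitions, no named facts.

## References
* [CohenPazuki2009] H. Cohen, F. Pazuki, *Elementary 3-descent with a 3-isogeny*, Acta Arith. 140 (2009),
  Def. 1.3, Thm. 2.1, §4 (the local images of `α` at the primes of bad reduction).
* [SilvermanAEC2009] J. H. Silverman, *The Arithmetic of Elliptic Curves*, 2nd ed. (2009), Prop. X.4.9 and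
  Ex. 10.19 (local images at multiplicative places), §VII.5.
* Tree templates: `TwoIsogenyLocalImageNode` (`2`-isogeny), `ThreeTorsionDescentValuation` (good places).
-/

noncomputable section

open scoped Classical WithZero

open WithZero (log)

namespace Valuation

variable {L : Type*} [Field L] (v : Valuation L ℤᵐ⁰)

/-- `a < 1`, `b ≤ 1` ⟹ `ab < 1` in the value group (bookkeeping). [folklore] -/
private theorem mul_lt_one_of_lt_of_le' {a b : ℤᵐ⁰} (ha : a < 1) (hb : b ≤ 1) : a * b < 1 :=
  calc a * b ≤ a * 1 := mul_le_mul' le_rfl hb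
    _ = a := mul_one a
    _ < 1 := ha

/-- `a ≤ 1`, `b ≤ 1` ⟹ `ab ≤ 1` in the value group (bookkeeping). [folklore] -/
private theorem mul_le_one_of_le_of_le' {a b : ℤᵐ⁰} (ha : a ≤ 1) (hb : b ≤ 1) : a * b ≤ 1 :=
  calc a * b ≤ 1 * 1 := mul_le_mul' ha hb
    _ = 1 := mul_one 1

/-- `v(y²) < 1 ⟹ v(y) < 1`. [folklore] -/
private theorem lt_one_of_sq_lt_one {y : L} (h : v (y ^ 2) < 1) : v y < 1 := by
  by_contra hle
  push Not at hle
  rw [map_pow, pow_two] at h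
  exact absurd (one_le_mul hle hle) (not_le.mpr h)

/-- `v(y²) ≤ 1 ⟹ v(y) ≤ 1`. [folklore] -/
private theorem le_one_of_sq_le_one {y : L} (h : v (y ^ 2) ≤ 1) : v y ≤ 1 := by
  by_contra hlt
  push Not at hlt
  rw [map_pow, pow_two] at h
  have : v y ≤ v y * v y := le_mul_of_one_le_right' hlt.le
  exact absurd (hlt.trans_le this) (not_lt.mpr h)

/-- Case (i) bookkeeping: `a (a + 2l) = x³` ⟹ `a = (a/x)³ (1 + 2l/a)`. [folklore] -/
private theorem key_i {x a l : L} (hx : x ≠ 0) (ha : a ≠ 0) (h : a * (a + 2 * l) = x ^ 3) :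
    a = (a / x) ^ 3 * (1 + 2 * l / a) := by
  have e : (a / x) ^ 3 * (1 + 2 * l / a) = a * (a * (a + 2 * l)) / x ^ 3 := by
    field_simp
  rw [e, h, mul_div_assoc, div_self (pow_ne_zero 3 hx), mul_one]

/-- The value at `T`: `(2s)² = (4μ²)³ (1 + δ(8μ³ + δ)/(16μ⁶))` for `s = 4μ³ + δ`. [folklore] -/
private theorem key_T {μ δ : L} (hμ : μ ≠ 0) (h16 : (16 : L) ≠ 0) :
    (2 * (4 * μ ^ 3 + δ)) ^ 2 = (4 * μ ^ 2) ^ 3 * (1 + δ * (8 * μ ^ 3 + δ) / (16 * μ ^ 6)) := by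
  field_simp
  ring

/-- Case (ii) bookkeeping: `a = (2μ)³ (1 + (a − 8μ³)/(8μ³))`. [folklore] -/
private theorem key_ii (a : L) {μ : L} (h8 : (8 : L) ≠ 0) (hμ : μ ≠ 0) :
    a = (2 * μ) ^ 3 * (1 + (a - 8 * μ ^ 3) / (8 * μ ^ 3)) := by
  field_simp
  ring

/-- Case (iii) bookkeeping: `u³ a = z³ − δ t` ⟹ `a = (z/u)³ (1 − δt/z³)`. [folklore] -/
private theorem key_iii {a u z t δ : L} (hu : u ≠ 0) (hz : z ≠ 0) (h : u ^ 3 * a = z ^ 3 - δ * t) :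
    a = (z / u) ^ 3 * (1 + -(δ * t) / z ^ 3) := by
  have e : (z / u) ^ 3 * (1 + -(δ * t) / z ^ 3) = (z ^ 3 - δ * t) / u ^ 3 := by
    field_simp
    ring
  rw [e, eq_div_iff (pow_ne_zero 3 hu)]
  linear_combination h

/-- Case (iv) bookkeeping: `a b = x³` ⟹ `a = (x/2μ)³ (1 + (8μ³ − b)/b)`. [folklore] -/
private theorem key_iv {a b x μ : L} (h2 : (2 : L) ≠ 0) (hμ : μ ≠ 0) (hb : b ≠ 0) (h : a * b = x ^ 3) :
    a = (x / (2 * μ)) ^ 3 * (1 + (8 * μ ^ 3 - b) / b) := by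
  have e : (x / (2 * μ)) ^ 3 * (1 + (8 * μ ^ 3 - b) / b) = x ^ 3 / b := by
    field_simp
    ring
  rw [e, eq_div_iff hb]
  exact h

open Literature.NumberTheory.EllipticCurves Literature.NumberTheory.EllipticCurves.ThreeTorsionDescent
  WeierstrassCurve in
/-- **The local image at a node off `T`.** For `W = threeTorsionModel m s : y² = x³ + (mx + s)²` over a field
with a `ℤᵐ⁰`-valued valuation `v` such that `v(2) = v(3) = 1`, `v(s) = 1` and `v(27s − 4m³) < 1` (multiplicative
reduction, `T = (0, s)` smooth modulo `v`): every value of the `3`-descent map is a cube times a `1`-unit,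
`α(P) = c³ (1 + ε)`, `c ≠ 0`, `v(ε) < 1`. Hence a `v`-unit in the local image of `α` has CUBE residue.
[cite: CohenPazuki2009, Theorem 2.1 and §4 (local images at p ∣ 27b − 4a³)] [cite: SilvermanAEC2009, Prop. X.4.9] -/
theorem threeTorsionDescent_eq_cube_mul_one_add {W : WeierstrassCurve L} {m s : L}
    (hW : W = threeTorsionModel m s) (h2 : v 2 = 1) (h3 : v 3 = 1) (hs : v s = 1)
    (hD : v (27 * s - 4 * m ^ 3) < 1) (P : W.toAffine.Point) :
    ∃ c ε : L, c ≠ 0 ∧ v ε < 1 ∧ descent W m s P = c ^ 3 * (1 + ε) := by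
  have h30 : (3 : L) ≠ 0 := fun h => by rw [h, map_zero] at h3; exact zero_ne_one h3
  have h20 : (2 : L) ≠ 0 := fun h => by rw [h, map_zero] at h2; exact zero_ne_one h2
  obtain ⟨μ, rfl⟩ : ∃ μ, m = 3 * μ := ⟨m / 3, by field_simp⟩
  obtain ⟨δ, rfl⟩ : ∃ δ, s = 4 * μ ^ 3 + δ := ⟨s - 4 * μ ^ 3, by ring⟩
  -- units `2, 3, 4, 8, 16, 27`
  have h4 : v (4 : L) = 1 := by rw [show (4 : L) = 2 ^ 2 by norm_num, map_pow, h2, one_pow]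
  have h8 : v (8 : L) = 1 := by rw [show (8 : L) = 2 ^ 3 by norm_num, map_pow, h2, one_pow]
  have h16 : v (16 : L) = 1 := by rw [show (16 : L) = 2 ^ 4 by norm_num, map_pow, h2, one_pow]
  have h27 : v (27 : L) = 1 := by rw [show (27 : L) = 3 ^ 3 by norm_num, map_pow, h3, one_pow]
  -- `v δ < 1`
  have hδ : v δ < 1 := by
    have e : 27 * (4 * μ ^ 3 + δ) - 4 * (3 * μ) ^ 3 = 27 * δ := by ring
    rw [e, map_mul, h27, one_mul] at hD
    exact hD
  -- `μ` is a unit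
  have hμ : v μ = 1 := by
    have e : v (4 * μ ^ 3) = 1 := by
      have e1 : 4 * μ ^ 3 = (4 * μ ^ 3 + δ) + -δ := by ring
      rw [e1, v.map_add_eq_of_lt_left (by rw [Valuation.map_neg, hs]; exact hδ), hs]
    rw [map_mul, h4, one_mul, map_pow] at e
    exact (pow_eq_one_iff.mp e).resolve_right (by norm_num)
  have hμ0 : μ ≠ 0 := fun h => by rw [h, map_zero] at hμ; exact zero_ne_one hμ
  have h2μ : v (2 * μ) = 1 := by rw [map_mul, h2, hμ, one_mul]
  have h8μ : v (8 * μ ^ 3) = 1 := by rw [map_mul, map_pow, h8, hμ, one_pow, one_mul]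
  rcases P with _ | ⟨x, y, hP⟩
  · refine ⟨1, 0, one_ne_zero, by rw [map_zero]; exact zero_lt_one, ?_⟩
    rw [← Affine.Point.zero_def, descent_zero]; ring
  · have heq : y ^ 2 = x ^ 3 + (3 * μ * x + (4 * μ ^ 3 + δ)) ^ 2 := by
      have := (equation_iff_of_eq hW x y).mp hP.1
      linear_combination this
    -- the same equation in the coordinate `u = x + 4μ²` centred at the node
    have heq' : y ^ 2 = (x + 4 * μ ^ 2) ^ 3 - 3 * μ ^ 2 * (x + 4 * μ ^ 2) ^ 2 +
        δ * (6 * μ * (x + 4 * μ ^ 2) - 16 * μ ^ 3 + δ) := by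
      rw [heq]; ring
    by_cases hy : y - 3 * μ * x - (4 * μ ^ 3 + δ) = 0
    · /- `P = T = (0, s)`: `α(T) = (2s)² = (4μ²)³ (1 + δ(8μ³ + δ)/(16μ⁶))` -/
      rw [descent_some_of_eq _ _ hP hy]
      refine ⟨4 * μ ^ 2, δ * (8 * μ ^ 3 + δ) / (16 * μ ^ 6), mul_ne_zero (by
        intro h; rw [h, map_zero] at h4; exact zero_ne_one h4) (pow_ne_zero 2 hμ0), ?_, ?_⟩
      · rw [map_div₀, map_mul, map_mul, h16, map_pow, hμ, one_pow, mul_one, div_one]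
        exact mul_lt_one_of_lt_of_le' hδ (v.map_add_le h8μ.le hδ.le)
      · exact key_T hμ0 (fun h => by rw [h, map_zero] at h16; exact zero_ne_one h16)
    · /- generic point: `α(P) = A = y − (mx + s) ≠ 0`, `AB = x³` -/
      rw [descent_some_of_ne _ _ hP hy]
      have hAB : (y - 3 * μ * x - (4 * μ ^ 3 + δ)) * (y + 3 * μ * x + (4 * μ ^ 3 + δ)) = x ^ 3 :=
        mul_conj_eq_cube hW hP.1
      by_cases hx1 : 1 < v x
      · /- (i) `x` not integral: `v(L) = v(x) < v(A)`, `A = (A/x)³ (1 + 2L/A)` -/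
        have hx0 : x ≠ 0 := fun h => by
          rw [h, map_zero] at hx1; exact (not_lt.mpr zero_le_one) hx1
        have hvx0 : v x ≠ 0 := (v.ne_zero_iff).mpr hx0
        have hL : v (3 * μ * x + (4 * μ ^ 3 + δ)) = v x := by
          have h1 : v (3 * μ * x) = v x := by rw [map_mul, map_mul, h3, hμ, one_mul, one_mul]
          rw [v.map_add_eq_of_lt_left (by rw [h1, hs]; exact hx1), h1]
        have hL0 : 3 * μ * x + (4 * μ ^ 3 + δ) ≠ 0 := fun h => by
          rw [h, map_zero] at hL; exact hvx0 hL.symm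
        have hB0 : y + 3 * μ * x + (4 * μ ^ 3 + δ) ≠ 0 := fun h => by
          rw [h, mul_zero] at hAB; exact pow_ne_zero 3 hx0 hAB.symm
        -- `v(L) < v(A)` by the logarithmic bookkeeping `log v A + log v B = 3 log v x`
        have hlt : v (3 * μ * x + (4 * μ ^ 3 + δ)) < v (y - 3 * μ * x - (4 * μ ^ 3 + δ)) := by
          have hlog : log (v (y - 3 * μ * x - (4 * μ ^ 3 + δ))) +
              log (v (y + 3 * μ * x + (4 * μ ^ 3 + δ))) = 3 * log (v x) := by
            rw [← v.log_map_mul hy hB0, hAB, v.log_map_pow]; norm_num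
          have hξ : 0 < log (v x) := by
            rw [← WithZero.log_one]
            exact (WithZero.log_lt_log one_ne_zero hvx0).mpr hx1
          by_contra hle
          push Not at hle
          -- then `v(B) ≤ max (v A, v 2L) ≤ v L = v x`
          have hB_le : v (y + 3 * μ * x + (4 * μ ^ 3 + δ)) ≤ v x := by
            have e : y + 3 * μ * x + (4 * μ ^ 3 + δ) =
                (y - 3 * μ * x - (4 * μ ^ 3 + δ)) + 2 * (3 * μ * x + (4 * μ ^ 3 + δ)) := by ring
            rw [e]
            refine v.map_add_le (hle.trans hL.le) ?_
            rw [map_mul, h2, one_mul, hL]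
          have hA_le : log (v (y - 3 * μ * x - (4 * μ ^ 3 + δ))) ≤ log (v x) :=
            (v.le_iff_log_le hy hx0).mp (hle.trans hL.le)
          have hB_le' : log (v (y + 3 * μ * x + (4 * μ ^ 3 + δ))) ≤ log (v x) :=
            (v.le_iff_log_le hB0 hx0).mp hB_le
          omega
        refine ⟨(y - 3 * μ * x - (4 * μ ^ 3 + δ)) / x,
          2 * (3 * μ * x + (4 * μ ^ 3 + δ)) / (y - 3 * μ * x - (4 * μ ^ 3 + δ)),
          div_ne_zero hy hx0, ?_, ?_⟩
        · rw [map_div₀, map_mul, h2, one_mul]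
          exact (div_lt_one₀ (lt_of_le_of_lt zero_le hlt)).mpr hlt
        · exact key_i hx0 hy (by linear_combination hAB)
      · push Not at hx1
        -- `x` integral; `u = x + 4μ²`
        have h4μ2 : v (4 * μ ^ 2) = 1 := by rw [map_mul, map_pow, h4, hμ, one_pow, mul_one]
        have hu_le : v (x + 4 * μ ^ 2) ≤ 1 := v.map_add_le hx1 h4μ2.le
        by_cases hu1 : v (x + 4 * μ ^ 2) < 1
        · /- (ii) the point reduces to the node: `v(y) < 1`, `A = 8μ³ (1 + ε)` -/
          have hy2 : v (y ^ 2) < 1 := by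
            rw [heq']
            refine v.map_add_lt (v.map_sub_lt ?_ ?_) ?_
            · rw [map_pow]
              exact pow_lt_one₀ zero_le hu1 three_ne_zero
            · rw [map_mul, map_mul, map_pow, map_pow, h3, hμ, one_pow, one_mul, one_mul]
              exact pow_lt_one₀ zero_le hu1 two_ne_zero
            · rw [map_mul]
              refine mul_lt_one_of_lt_of_le' hδ (v.map_add_le (v.map_sub_le ?_ ?_) hδ.le)
              · rw [map_mul, map_mul, hμ, mul_one]
                have h6 : v (6 : L) = 1 := by rw [show (6 : L) = 2 * 3 by norm_num, map_mul, h2, h3, mul_one]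
                rw [h6, one_mul]; exact hu_le
              · rw [map_mul, map_pow, h16, hμ, one_pow, mul_one]
          have hy1 : v y < 1 := lt_one_of_sq_lt_one v hy2
          refine ⟨2 * μ, (y - 3 * μ * x - (4 * μ ^ 3 + δ) - 8 * μ ^ 3) / (8 * μ ^ 3),
            mul_ne_zero h20 hμ0, ?_, ?_⟩
          · rw [map_div₀, h8μ, div_one]
            have e : y - 3 * μ * x - (4 * μ ^ 3 + δ) - 8 * μ ^ 3 = y - 3 * μ * (x + 4 * μ ^ 2) - δ := by ring
            rw [e]
            refine v.map_sub_lt (v.map_sub_lt hy1 ?_) hδ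
            rw [map_mul, map_mul, h3, hμ, one_mul, one_mul]; exact hu1
          · exact key_ii _ (fun h => by rw [h, map_zero] at h8; exact zero_ne_one h8) hμ0
        · have hu : v (x + 4 * μ ^ 2) = 1 := le_antisymm hu_le (not_lt.mp hu1)
          have hu0 : x + 4 * μ ^ 2 ≠ 0 := fun h => by rw [h, map_zero] at hu; exact zero_ne_one hu
          -- `y` is integral
          have hy_le : v y ≤ 1 := by
            refine le_one_of_sq_le_one v ?_
            rw [heq]
            refine v.map_add_le ?_ ?_
            · rw [map_pow]; exact pow_le_one₀ zero_le hx1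
            · rw [map_pow]
              refine pow_le_one₀ zero_le (v.map_add_le ?_ hs.le)
              rw [map_mul, map_mul, h3, hμ, one_mul, one_mul]; exact hx1
          -- `z = y − μu`
          have hz_le : v (y - μ * (x + 4 * μ ^ 2)) ≤ 1 :=
            v.map_sub_le hy_le (by rw [map_mul, hμ, hu, mul_one])
          have hR_le : v (6 * μ * (x + 4 * μ ^ 2) - 16 * μ ^ 3 + δ) ≤ 1 := by
            refine v.map_add_le (v.map_sub_le ?_ ?_) hδ.le
            · rw [map_mul, map_mul, hμ, hu, mul_one, mul_one,
                show (6 : L) = 2 * 3 by norm_num, map_mul, h2, h3, mul_one]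
            · rw [map_mul, map_pow, h16, hμ, one_pow, mul_one]
          by_cases hz1 : v (y - μ * (x + 4 * μ ^ 2)) < 1
          · /- (iv) the point reduces to `T`: `v(x) < 1`, `B ≡ 8μ³`, `A = x³/B` -/
            have hxu : (x + 4 * μ ^ 2) ^ 2 * x = 2 * μ * (x + 4 * μ ^ 2) * (y - μ * (x + 4 * μ ^ 2)) +
                (y - μ * (x + 4 * μ ^ 2)) ^ 2 - δ * (6 * μ * (x + 4 * μ ^ 2) - 16 * μ ^ 3 + δ) := by
              linear_combination (-1 : L) * heq'
            have hx_lt : v x < 1 := by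
              have e : v ((x + 4 * μ ^ 2) ^ 2 * x) = v x := by rw [map_mul, map_pow, hu, one_pow, one_mul]
              rw [← e, hxu]
              refine v.map_sub_lt (v.map_add_lt ?_ ?_) ?_
              · rw [map_mul, map_mul, h2μ, hu, one_mul, one_mul]; exact hz1
              · rw [map_pow]; exact pow_lt_one₀ zero_le hz1 two_ne_zero
              · rw [map_mul]; exact mul_lt_one_of_lt_of_le' hδ hR_le
            have hB8 : v (y + 3 * μ * x + (4 * μ ^ 3 + δ) - 8 * μ ^ 3) < 1 := by
              have e : y + 3 * μ * x + (4 * μ ^ 3 + δ) - 8 * μ ^ 3 =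
                  4 * μ * x + (y - μ * (x + 4 * μ ^ 2)) + δ := by ring
              rw [e]
              refine v.map_add_lt (v.map_add_lt ?_ hz1) hδ
              rw [map_mul, map_mul, h4, hμ, one_mul, one_mul]; exact hx_lt
            have hB : v (y + 3 * μ * x + (4 * μ ^ 3 + δ)) = 1 := by
              have e : y + 3 * μ * x + (4 * μ ^ 3 + δ) =
                  8 * μ ^ 3 + (y + 3 * μ * x + (4 * μ ^ 3 + δ) - 8 * μ ^ 3) := by ring
              rw [e, v.map_add_eq_of_lt_left (by rw [h8μ]; exact hB8), h8μ]
            have hB0 : y + 3 * μ * x + (4 * μ ^ 3 + δ) ≠ 0 := fun h => by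
              rw [h, map_zero] at hB; exact zero_ne_one hB
            have hx0 : x ≠ 0 := by
              intro h
              subst h
              rw [zero_pow three_ne_zero, mul_eq_zero] at hAB
              exact hAB.elim hy hB0
            refine ⟨x / (2 * μ), (8 * μ ^ 3 - (y + 3 * μ * x + (4 * μ ^ 3 + δ))) /
              (y + 3 * μ * x + (4 * μ ^ 3 + δ)), div_ne_zero hx0 (mul_ne_zero h20 hμ0), ?_, ?_⟩
            · rw [map_div₀, hB, div_one, ← Valuation.map_neg, neg_sub]; exact hB8
            · exact key_iv h20 hμ0 hB0 hAB
          · /- (iii) generic smooth reduction: `z` a unit, `u³ A = z³ − δ(u³ + (y − 3μu) R)` -/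
            have hz : v (y - μ * (x + 4 * μ ^ 2)) = 1 := le_antisymm hz_le (not_lt.mp hz1)
            have hz0 : y - μ * (x + 4 * μ ^ 2) ≠ 0 := fun h => by rw [h, map_zero] at hz; exact zero_ne_one hz
            have hid : (x + 4 * μ ^ 2) ^ 3 * (y - 3 * μ * x - (4 * μ ^ 3 + δ)) =
                (y - μ * (x + 4 * μ ^ 2)) ^ 3 - δ * ((x + 4 * μ ^ 2) ^ 3 +
                  (y - 3 * μ * (x + 4 * μ ^ 2)) * (6 * μ * (x + 4 * μ ^ 2) - 16 * μ ^ 3 + δ)) := by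
              linear_combination (-(y - 3 * μ * (x + 4 * μ ^ 2))) * heq'
            refine ⟨(y - μ * (x + 4 * μ ^ 2)) / (x + 4 * μ ^ 2),
              -(δ * ((x + 4 * μ ^ 2) ^ 3 + (y - 3 * μ * (x + 4 * μ ^ 2)) *
                (6 * μ * (x + 4 * μ ^ 2) - 16 * μ ^ 3 + δ))) / (y - μ * (x + 4 * μ ^ 2)) ^ 3,
              div_ne_zero hz0 hu0, ?_, ?_⟩
            · rw [map_div₀, map_pow, hz, one_pow, div_one, Valuation.map_neg, map_mul]
              refine mul_lt_one_of_lt_of_le' hδ (v.map_add_le ?_ ?_)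
              · rw [map_pow, hu, one_pow]
              · rw [map_mul]
                refine mul_le_one_of_le_of_le' (v.map_sub_le hy_le ?_) hR_le
                rw [map_mul, map_mul, h3, hμ, hu, one_mul, one_mul]
            · exact key_iii hu0 hz0 hid

/-- `(1 + ε)ⁿ = 1 + ε'` with `v(ε') < 1` when `v(ε) < 1` (`1 + 𝔪_v` is a subgroup). [folklore] -/
private theorem exists_one_add_pow_eq_one_add {ε : L} (hε : v ε < 1) (n : ℕ) :
    ∃ ε' : L, v ε' < 1 ∧ (1 + ε) ^ n = 1 + ε' := by
  induction n with
  | zero => exact ⟨0, by rw [map_zero]; exact zero_lt_one, by rw [pow_zero, add_zero]⟩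
  | succ n ih =>
    obtain ⟨ε', hε', hn⟩ := ih
    refine ⟨ε' + ε + ε' * ε, v.map_add_lt (v.map_add_lt hε' hε) ?_, by rw [pow_succ, hn]; ring⟩
    rw [map_mul]
    exact mul_lt_one_of_lt_of_le' hε' hε.le

open Literature.NumberTheory.EllipticCurves Literature.NumberTheory.EllipticCurves.ThreeTorsionDescent
  WeierstrassCurve in
/-- **Local condition at a node off `T`, in the form used to KILL Selmer candidates.** Under the hypotheses of
`threeTorsionDescent_eq_cube_mul_one_add`: if `α(P)^e = u · w³` for a point `P`, some `e ∈ ℕ` and `w ≠ 0` (the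
output of local necessity, `CPMuDescentLocal.exists_descent_pow_eq_of_torsorClass_mem_localRestrictionKer`), then
`u = c³ (1 + ε)` with `c ≠ 0`, `v(ε) < 1`; in particular a `v`-unit `u` has cube residue.
[cite: CohenPazuki2009, Theorem 2.1 and §4] [cite: SilvermanAEC2009, Prop. X.4.9] -/
theorem eq_cube_mul_one_add_of_threeTorsionDescent_pow_eq {W : WeierstrassCurve L} {m s : L}
    (hW : W = threeTorsionModel m s) (h2 : v 2 = 1) (h3 : v 3 = 1) (hs : v s = 1)
    (hD : v (27 * s - 4 * m ^ 3) < 1) {P : W.toAffine.Point} {u w : L} {e : ℕ} (hw : w ≠ 0)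
    (h : descent W m s P ^ e = u * w ^ 3) : ∃ c ε : L, c ≠ 0 ∧ v ε < 1 ∧ u = c ^ 3 * (1 + ε) := by
  obtain ⟨c, ε, hc, hε, hP⟩ := v.threeTorsionDescent_eq_cube_mul_one_add hW h2 h3 hs hD P
  obtain ⟨ε', hε', hn⟩ := v.exists_one_add_pow_eq_one_add hε e
  refine ⟨c ^ e / w, ε', div_ne_zero (pow_ne_zero e hc) hw, hε', ?_⟩
  rw [hP, mul_pow, ← pow_mul, hn, mul_comm 3 e, pow_mul] at h
  rw [div_pow, div_mul_eq_mul_div, eq_div_iff (pow_ne_zero 3 hw)]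
  exact h.symm

end Valuation

end
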